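import Literature.NumberTheory.ComplexMultiplication.CMTypeRankSharedCharacter
import HarnessLib

/-!
# A shared ODD character of ANY order forces a rank defect; nondegenerate slots pair non-trivially with every
# semi-invariant weight (the obstruction behind `Hg(A₀ × A₁) ⊊ Hg(A₀) × Hg(A₁)` for CM fields with a common CM subfield
# carrying an odd abelian character)

Companion of `NumberTheory/ComplexMultiplication/CMTypeRankSharedCharacter` (notation: a group `G` acts on the slots
`E_i`, `Φ_i ⊆ E_i`, `Σ = sigmaType Φ`, `U(·) = antiSpan G ·`, `u_g = antiVec · g`, `rank = dim U + 1`; on Hodge groups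
`rank(Σ) − 1 = rank Hg(∏_i A_{Φ_i})`).  That file proves: two slots `i₀ ≠ i₁` carrying RATIONAL weights `f_k : E_{i_k} → ℚ`
transforming under one and the same `χ : G → ℚ` and pairing non-trivially with `u_1(Φ_{i_k})` make the rank of the family
NON-additive.  Rational-valued semi-invariant weights only see characters of order `≤ 2` (sign characters of imaginary
quadratic fields).  This file removes that restriction and supplies the pairing hypothesis from nondegeneracy:

* **`finrank_antiSpan_sigmaType_lt_of_shared'`**, **`typeRank_sigmaType_add_card_lt_of_shared'`**,
  `typeRank_sigmaType_lt_of_shared'`, `typeRank_sigmaType_ne_of_shared'`,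
  `not_forall_exists_partialConj_of_shared'` — the same statements for weights `f_k : E_{i_k} → F` with values in ANY
  field `F` of characteristic zero (e.g. `F = ℂ`: characters of any finite order), `χ : G → F`: the separating form
  `λ(w) = c₁ Σ_x w(i₀,x) f₀(x) − c₀ Σ_x w(i₁,x) f₁(x)` is now `ℚ`-linear with values in `F`; it still kills every
  simultaneous translate `u_g(Σ)` (both sums pick up `χ(g⁻¹)`) and not `ext_{i₀} u_1(Φ_{i₀}) ∈ ⊕_i ext_i U(Φ_i)`.
* **`IsCMTypeWith.eq_zero_of_forall_sum_mul_antiVec_eq_zero`** — a NONDEGENERATE slot (`rank(Φ) = |E|/2 + 1`, i.e.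
  `U(Φ)` = all `ρ`-antisymmetric weights) has no non-zero `ρ`-antisymmetric `F`-valued weight orthogonal to all its
  translates `u_g(Φ)`: `U(Φ)` contains `δ_x − δ_{ρx}`, whose pairing with `f` is `f(x) − f(ρx) = 2 f(x)`.
* **`IsCMTypeWith.sum_mul_antiVec_ne_zero_of_typeRank_eq`** — hence a non-zero weight `f` with `f(g • x) = χ(g) f(x)`
  for an ODD `χ` (`χ(ρ) = −1`) pairs non-trivially with `u_1(Φ)` on a nondegenerate slot
  (`Σ_x f(x) u_g(x) = χ(g⁻¹) Σ_x f(x) u_1(x)`, `sum_mul_cast_antiVec_eq`).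
* **`typeRank_sigmaType_add_card_lt_of_shared_odd`**, **`typeRank_sigmaType_lt_of_shared_odd`**,
  `typeRank_sigmaType_ne_of_shared_odd`, `not_forall_exists_partialConj_of_shared_odd` — CONSEQUENTLY: two
  NONDEGENERATE slots `i₀ ≠ i₁` carrying non-zero weights semi-invariant under one odd `χ` are never additive
  (`rank(Σ) + |I| < Σ_i rank(Φ_i) + 1`), the family `Σ` is DEGENERATE (`rank(Σ) < |⊔_i E_i|/2 + 1`) whatever the other
  members, and some slot has no partial conjugation.  For `G = Aut(ℂ)` on `E_i = Hom(K_i, ℂ)`: an odd character of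
  `Aut(ℂ)` factoring through a normal subfield `F₀ ⊆ ℂ` contained in every `s(K_{i₀})` and every `s(K_{i₁})` (e.g. two
  ABELIAN CM fields meeting in a CM field; nested cyclotomic fields) makes `A₀^a × A₁^b` carry exceptional Hodge classes
  for NONDEGENERATE `A₀`, `A₁` (number-field form: `SharedOddCharacterDegenerate`).  This is the exact converse, for
  abelian Galois closures, of the pairwise "no common constituent" criterion (`CMTypeRankCommonConstituent`).

Everything is proved; no definition, no named fact, no `sorry`.

## References

* [Kubota1965] T. Kubota, *On the field extension by complex multiplication*, Trans. AMS 118 (1965), §4 Lemma 2 (the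
  odd characters `ψ(ρ) = −1` of an abelian CM field govern the rank).
* [Gordon1999HodgeAVSurvey] B. B. Gordon, *A survey of the Hodge conjecture for abelian varieties*, §3 Theorem (Imai,
  Murty) and its proof (the character-group computation), 7.5–7.7 (Murty, Hazama), Prop. 9.4.1.
* [Deligne1982HodgeCycles] P. Deligne, *Hodge cycles on abelian varieties*, LNM 900 (1982), I Ex. 3.7.
-/

set_option autoImplicit false

noncomputable section

open scoped BigOperators

namespace Literature.NumberTheory.ComplexMultiplication

variable {G : Type*} [Group G] {I : Type*} {E : I → Type*} [∀ i, MulAction G (E i)]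
variable {F : Type*} [Field F] [CharZero F]

/-! ### Pairings with weights valued in a field of characteristic zero -/

section Pairing

variable {X : Type*} [MulAction G X] [Fintype X]

omit [CharZero F] in
/-- **The pairing of a translate with a `χ`-semi-invariant `F`-valued weight**: if `f(g • x) = χ(g) f(x)` then
`Σ_x f(x) u_g(x) = χ(g⁻¹) Σ_x f(x) u_1(x)`. [cite: Gordon1999HodgeAVSurvey, §3 Theorem (proof)] -/
theorem sum_mul_cast_antiVec_eq (Ψ : Set X) (χ : G → F) (f : X → F)
    (hf : ∀ (g : G) (x : X), f (g • x) = χ g * f x) (g : G) :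
    ∑ x, f x * (antiVec Ψ g x : F) = χ g⁻¹ * ∑ x, f x * (antiVec Ψ (1 : G) x : F) := by
  calc ∑ x, f x * (antiVec Ψ g x : F) = ∑ x, χ g⁻¹ * (f (g • x) * (antiVec Ψ (1 : G) (g • x) : F)) := by
        refine Finset.sum_congr rfl fun x _ => ?_
        rw [antiVec_eq_antiVec_one_smul Ψ g x, ← mul_assoc, ← hf g⁻¹ (g • x), inv_smul_smul]
    _ = χ g⁻¹ * ∑ x, f (g • x) * (antiVec Ψ (1 : G) (g • x) : F) := by rw [Finset.mul_sum]
    _ = χ g⁻¹ * ∑ x, f x * (antiVec Ψ (1 : G) x : F) := by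
        congr 1
        exact Equiv.sum_comp (MulAction.toPerm g) (fun y => f y * (antiVec Ψ (1 : G) y : F))

omit [CharZero F] [Fintype X] in
/-- A semi-invariant weight under an odd `χ` (`χ(ρ) = −1`) is `ρ`-antisymmetric. [folklore] -/
private theorem antisymm_of_semiInvariant {ρ : G} (χ : G → F) (hρ : χ ρ = -1) (f : X → F)
    (hf : ∀ (g : G) (x : X), f (g • x) = χ g * f x) (x : X) : f (ρ • x) = -f x := by
  rw [hf, hρ, neg_one_mul]

namespace IsCMTypeWith

variable {ρ : G} {Φ : Set X} (h : IsCMTypeWith ρ Φ)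
include h

/-- **A nondegenerate slot has no non-zero antisymmetric weight orthogonal to all its translates.**  If
`rank(Φ) = |E|/2 + 1` (so `U(Φ)` is the space of ALL `ρ`-antisymmetric rational weights), `f : E → F` satisfies
`f(ρx) = −f(x)` and `Σ_x f(x) u_g(x) = 0` for every `g`, then `f = 0`: the pairing `w ↦ Σ_x w(x) f(x)` is `ℚ`-linear,
vanishes on `U(Φ) ∋ δ_x − δ_{ρx}`, and `Σ_y (δ_x − δ_{ρx})(y) f(y) = f(x) − f(ρx) = 2 f(x)`.
[cite: Kubota1965, §2 (p. 115)] -/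
theorem eq_zero_of_forall_sum_mul_antiVec_eq_zero [Nonempty X] (hnd : typeRank G Φ = Fintype.card X / 2 + 1)
    (f : X → F) (hanti : ∀ x, f (ρ • x) = -f x)
    (horth : ∀ g : G, ∑ x, f x * (antiVec Φ g x : F) = 0) : f = 0 := by
  classical
  -- the pairing with `f`, a `ℚ`-linear form on `ℚ^E` with values in `F`
  let P : (X → ℚ) →ₗ[ℚ] F :=
    { toFun := fun w => ∑ x, (w x : F) * f x
      map_add' := fun w w' => by
        simp only [Pi.add_apply, Rat.cast_add, add_mul, Finset.sum_add_distrib]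
      map_smul' := fun c w => by
        simp only [Pi.smul_apply, smul_eq_mul, Rat.cast_mul, RingHom.id_apply, Rat.smul_def, Finset.mul_sum,
          mul_assoc] }
  have hP : ∀ w : X → ℚ, P w = ∑ x, (w x : F) * f x := fun w => rfl
  -- it kills `U(Φ)`, which is everything antisymmetric
  have hker : antiSpan G Φ ≤ LinearMap.ker P := by
    refine Submodule.span_le.2 ?_
    rintro _ ⟨g, rfl⟩
    rw [SetLike.mem_coe, LinearMap.mem_ker, hP]
    rw [← horth g]
    exact Finset.sum_congr rfl fun x _ => mul_comm _ _
  rw [(h.typeRank_eq_iff_antiSpan_eq).1 hnd] at hker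
  funext x₀
  -- `δ_{x₀} − δ_{ρx₀}` is antisymmetric
  have key1 : ∀ y : X, (ρ • y = x₀ ↔ y = ρ • x₀) := fun y =>
    ⟨fun hy => by rw [← hy, h.invol], fun hy => by rw [hy, h.invol]⟩
  have key2 : ∀ y : X, (ρ • y = ρ • x₀ ↔ y = x₀) := fun y =>
    ⟨fun hy => by simpa only [h.invol] using congrArg (fun z => ρ • z) hy, fun hy => by rw [hy]⟩
  let d : X → ℚ := fun y => (if y = x₀ then (1 : ℚ) else 0) - if y = ρ • x₀ then (1 : ℚ) else 0
  have hd : d ∈ antiWeights (E := X) ρ := by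
    intro y
    show ((if ρ • y = x₀ then (1 : ℚ) else 0) - if ρ • y = ρ • x₀ then (1 : ℚ) else 0) =
      -((if y = x₀ then (1 : ℚ) else 0) - if y = ρ • x₀ then (1 : ℚ) else 0)
    simp only [key1 y, key2 y]
    ring
  have h0 : P d = 0 := LinearMap.mem_ker.1 (hker hd)
  rw [hP] at h0
  have hsum : ∑ x, ((d x : ℚ) : F) * f x = f x₀ - f (ρ • x₀) := by
    have hdx : ∀ x, ((d x : ℚ) : F) = (if x = x₀ then (1 : F) else 0) - if x = ρ • x₀ then (1 : F) else 0 := by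
      intro x
      show ((((if x = x₀ then (1 : ℚ) else 0) - if x = ρ • x₀ then (1 : ℚ) else 0 : ℚ) : ℚ) : F) = _
      split_ifs <;> norm_num
    simp only [hdx, sub_mul, Finset.sum_sub_distrib, ite_mul, one_mul, zero_mul, Finset.sum_ite_eq',
      Finset.mem_univ, if_true]
  rw [hsum, hanti, sub_neg_eq_add] at h0
  have h2 : (2 : F) * f x₀ = 0 := by rw [two_mul]; exact h0
  simpa using h2

/-- **Nondegenerate slots pair non-trivially with every non-zero odd semi-invariant weight**: if `rank(Φ) = |E|/2 + 1`,
`f ≠ 0` and `f(g • x) = χ(g) f(x)` with `χ(ρ) = −1`, then `c = Σ_x f(x) u_1(Φ)(x) ≠ 0` (all pairings `Σ_x f u_g` are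
`χ(g⁻¹) c`; if `c = 0` the previous lemma gives `f = 0`).  On an abelian CM field this is one half of Kubota's Lemma 2
(a nondegenerate type has `Σ_{s∈Φ} χ(s) ≠ 0` for every odd character `χ`); here `G` and `χ` are arbitrary.
[cite: Kubota1965, §4 Lemma 2] -/
theorem sum_mul_antiVec_ne_zero_of_typeRank_eq [Nonempty X] (hnd : typeRank G Φ = Fintype.card X / 2 + 1)
    (χ : G → F) (hρ : χ ρ = -1) (f : X → F) (hf : ∀ (g : G) (x : X), f (g • x) = χ g * f x) (hf0 : f ≠ 0) :
    ∑ x, f x * (antiVec Φ (1 : G) x : F) ≠ 0 := by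
  intro hc
  refine hf0 (h.eq_zero_of_forall_sum_mul_antiVec_eq_zero hnd f (antisymm_of_semiInvariant χ hρ f hf) fun g => ?_)
  rw [sum_mul_cast_antiVec_eq Φ χ f hf g, hc, mul_zero]

end IsCMTypeWith

end Pairing

/-! ### The obstruction for weights valued in a field of characteristic zero -/

section Shared

variable [DecidableEq I] [Fintype I] [∀ i, Fintype (E i)]

/-- **Two slots seeing the same `F`-valued character are never additive.**  Let `f₀ : E_{i₀} → F`, `f₁ : E_{i₁} → F`
(`i₀ ≠ i₁`, `F` a field of characteristic zero) satisfy `f_k(g • x) = χ(g) f_k(x)` for one and the same `χ : G → F`, and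
`c_k = Σ_x f_k(x) u_1(Φ_{i_k})(x) ≠ 0`.  Then `dim U(Σ) < Σ_i dim U(Φ_i)`: the `ℚ`-linear form
`λ(w) = c₁ Σ_x w(i₀,x) f₀(x) − c₀ Σ_x w(i₁,x) f₁(x)` (values in `F`) vanishes on every `u_g(Σ)` but not on
`ext_{i₀} u_1(Φ_{i₀}) ∈ ⊕_i ext_i U(Φ_i)`. [cite: Gordon1999HodgeAVSurvey, §3 Theorem (proof) and 7.5] -/
theorem finrank_antiSpan_sigmaType_lt_of_shared' (Φ : ∀ i, Set (E i)) {i₀ i₁ : I} (h01 : i₀ ≠ i₁) (χ : G → F)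
    (f₀ : E i₀ → F) (f₁ : E i₁ → F) (hf₀ : ∀ (g : G) (x : E i₀), f₀ (g • x) = χ g * f₀ x)
    (hf₁ : ∀ (g : G) (x : E i₁), f₁ (g • x) = χ g * f₁ x)
    (hc₀ : ∑ x, f₀ x * (antiVec (Φ i₀) (1 : G) x : F) ≠ 0)
    (hc₁ : ∑ x, f₁ x * (antiVec (Φ i₁) (1 : G) x : F) ≠ 0) :
    Module.finrank ℚ (antiSpan G (sigmaType Φ)) < ∑ i, Module.finrank ℚ (antiSpan G (Φ i)) := by
  set c₀ := ∑ x, f₀ x * (antiVec (Φ i₀) (1 : G) x : F) with hc₀def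
  set c₁ := ∑ x, f₁ x * (antiVec (Φ i₁) (1 : G) x : F) with hc₁def
  -- the separating `ℚ`-linear form with values in `F`
  let lam : ((Σ j, E j) → ℚ) →ₗ[ℚ] F :=
    { toFun := fun w => c₁ * (∑ x, f₀ x * (w ⟨i₀, x⟩ : F)) - c₀ * ∑ x, f₁ x * (w ⟨i₁, x⟩ : F)
      map_add' := fun w w' => by
        simp only [Pi.add_apply, Rat.cast_add, mul_add, Finset.sum_add_distrib]
        ring
      map_smul' := fun c w => by
        simp only [Pi.smul_apply, smul_eq_mul, Rat.cast_mul, RingHom.id_apply, Rat.smul_def, Finset.mul_sum]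
        rw [mul_sub]
        congr 1
        · rw [Finset.mul_sum]
          exact Finset.sum_congr rfl fun x _ => by ring
        · rw [Finset.mul_sum]
          exact Finset.sum_congr rfl fun x _ => by ring }
  have hlam : ∀ w : (Σ j, E j) → ℚ,
      lam w = c₁ * (∑ x, f₀ x * (w ⟨i₀, x⟩ : F)) - c₀ * ∑ x, f₁ x * (w ⟨i₁, x⟩ : F) := fun w => rfl
  -- `λ` kills every simultaneous translate, hence `U(Σ)`
  have hker : antiSpan G (sigmaType Φ) ≤ LinearMap.ker lam := by
    refine Submodule.span_le.2 ?_
    rintro _ ⟨g, rfl⟩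
    rw [SetLike.mem_coe, LinearMap.mem_ker, hlam]
    simp only [antiVec_sigmaType]
    rw [sum_mul_cast_antiVec_eq (Φ i₀) χ f₀ hf₀ g, sum_mul_cast_antiVec_eq (Φ i₁) χ f₁ hf₁ g, ← hc₀def, ← hc₁def]
    ring
  -- `ext_{i₀} u_1(Φ_{i₀})` lies in `⊕_i ext_i U(Φ_i)` but not in `ker λ`
  set W := LinearMap.range (sigmaLift ∘ₗ LinearMap.pi fun i => (antiSpan G (Φ i)).subtype ∘ₗ LinearMap.proj i)
    with hWdef
  have hvW : slotExt i₀ (antiVec (Φ i₀) (1 : G)) ∈ W := by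
    refine ⟨Pi.single i₀ ⟨antiVec (Φ i₀) (1 : G), Submodule.subset_span ⟨1, rfl⟩⟩, ?_⟩
    funext x
    obtain ⟨j, s⟩ := x
    change ((Pi.single (M := fun i => antiSpan G (Φ i)) i₀
      ⟨antiVec (Φ i₀) (1 : G), Submodule.subset_span ⟨1, rfl⟩⟩ j : antiSpan G (Φ j)) : E j → ℚ) s =
      slotExt i₀ (antiVec (Φ i₀) (1 : G)) ⟨j, s⟩
    by_cases hj : j = i₀
    · subst hj
      rw [Pi.single_eq_same, slotExt_apply_same]
    · rw [Pi.single_eq_of_ne hj, slotExt_apply_of_ne hj]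
      rfl
  have hvl : lam (slotExt i₀ (antiVec (Φ i₀) (1 : G))) ≠ 0 := by
    rw [hlam]
    simp only [slotExt_apply_same, slotExt_apply_of_ne h01.symm, Rat.cast_zero, mul_zero, Finset.sum_const_zero,
      sub_zero]
    rw [← hc₀def]
    exact mul_ne_zero hc₁ hc₀
  -- strictness
  have hlt : antiSpan G (sigmaType Φ) < W := by
    refine lt_of_le_of_ne (antiSpan_sigmaType_le_range Φ) fun heq => hvl ?_
    have hv : slotExt i₀ (antiVec (Φ i₀) (1 : G)) ∈ antiSpan G (sigmaType Φ) := by rw [heq]; exact hvW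
    exact LinearMap.mem_ker.1 (hker hv)
  calc Module.finrank ℚ (antiSpan G (sigmaType Φ))
      < Module.finrank ℚ W := Submodule.finrank_lt_finrank_of_lt hlt
    _ ≤ Module.finrank ℚ (∀ i, antiSpan G (Φ i)) := LinearMap.finrank_range_le _
    _ = ∑ i, Module.finrank ℚ (antiSpan G (Φ i)) := Module.finrank_pi_fintype ℚ

/-- **The rank is NOT additive** under a shared `F`-valued character with non-zero pairings:
`rank(Σ) + |I| < Σ_i rank(Φ_i) + 1` (`rank Hg(∏_i A_i) < Σ_i rank Hg(A_i)`).
[cite: Gordon1999HodgeAVSurvey, §3 Theorem (proof) and 7.5] -/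
theorem typeRank_sigmaType_add_card_lt_of_shared' [Nonempty I] [∀ i, Nonempty (E i)] {ρ : G}
    {Φ : ∀ i, Set (E i)} (h : ∀ i, IsCMTypeWith ρ (Φ i)) {i₀ i₁ : I} (h01 : i₀ ≠ i₁) (χ : G → F)
    (f₀ : E i₀ → F) (f₁ : E i₁ → F) (hf₀ : ∀ (g : G) (x : E i₀), f₀ (g • x) = χ g * f₀ x)
    (hf₁ : ∀ (g : G) (x : E i₁), f₁ (g • x) = χ g * f₁ x)
    (hc₀ : ∑ x, f₀ x * (antiVec (Φ i₀) (1 : G) x : F) ≠ 0)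
    (hc₁ : ∑ x, f₁ x * (antiVec (Φ i₁) (1 : G) x : F) ≠ 0) :
    typeRank G (sigmaType Φ) + Fintype.card I < (∑ i, typeRank G (Φ i)) + 1 := by
  obtain ⟨j₀⟩ := ‹Nonempty I›
  haveI : Nonempty (Σ i, E i) := ⟨⟨j₀, Classical.arbitrary (E j₀)⟩⟩
  rw [(IsCMTypeWith.sigmaType h).typeRank_eq_finrank_antiSpan_add_one,
    Finset.sum_congr rfl fun i _ => (h i).typeRank_eq_finrank_antiSpan_add_one, Finset.sum_add_distrib,
    Finset.sum_const, Finset.card_univ, smul_eq_mul, mul_one]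
  have := finrank_antiSpan_sigmaType_lt_of_shared' Φ h01 χ f₀ f₁ hf₀ hf₁ hc₀ hc₁
  omega

/-- **A shared `F`-valued character forces DEGENERACY of the family**: `rank(Σ) < |⊔_i E_i|/2 + 1`, whatever the other
members. [cite: Gordon1999HodgeAVSurvey, 7.5–7.7] -/
theorem typeRank_sigmaType_lt_of_shared' [Nonempty I] [∀ i, Nonempty (E i)] {ρ : G} {Φ : ∀ i, Set (E i)}
    (h : ∀ i, IsCMTypeWith ρ (Φ i)) {i₀ i₁ : I} (h01 : i₀ ≠ i₁) (χ : G → F) (f₀ : E i₀ → F) (f₁ : E i₁ → F)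
    (hf₀ : ∀ (g : G) (x : E i₀), f₀ (g • x) = χ g * f₀ x) (hf₁ : ∀ (g : G) (x : E i₁), f₁ (g • x) = χ g * f₁ x)
    (hc₀ : ∑ x, f₀ x * (antiVec (Φ i₀) (1 : G) x : F) ≠ 0)
    (hc₁ : ∑ x, f₁ x * (antiVec (Φ i₁) (1 : G) x : F) ≠ 0) :
    typeRank G (sigmaType Φ) < Fintype.card (Σ i, E i) / 2 + 1 := by
  have hlt := typeRank_sigmaType_add_card_lt_of_shared' h h01 χ f₀ f₁ hf₀ hf₁ hc₀ hc₁
  have hle : ∀ i, typeRank G (Φ i) ≤ Fintype.card (E i) / 2 + 1 := fun i => (h i).typeRank_le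
  have hsum : ∑ i, typeRank G (Φ i) ≤ ∑ i, (Fintype.card (E i) / 2 + 1) := Finset.sum_le_sum fun i _ => hle i
  rw [Finset.sum_add_distrib, Finset.sum_const, Finset.card_univ, smul_eq_mul, mul_one] at hsum
  rw [card_sigma_div_two h]
  omega

/-- … so `Σ` is not nondegenerate (`rank(Σ) ≠ |⊔_i E_i|/2 + 1`). [cite: Gordon1999HodgeAVSurvey, 7.5–7.7] -/
theorem typeRank_sigmaType_ne_of_shared' [Nonempty I] [∀ i, Nonempty (E i)] {ρ : G} {Φ : ∀ i, Set (E i)}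
    (h : ∀ i, IsCMTypeWith ρ (Φ i)) {i₀ i₁ : I} (h01 : i₀ ≠ i₁) (χ : G → F) (f₀ : E i₀ → F) (f₁ : E i₁ → F)
    (hf₀ : ∀ (g : G) (x : E i₀), f₀ (g • x) = χ g * f₀ x) (hf₁ : ∀ (g : G) (x : E i₁), f₁ (g • x) = χ g * f₁ x)
    (hc₀ : ∑ x, f₀ x * (antiVec (Φ i₀) (1 : G) x : F) ≠ 0)
    (hc₁ : ∑ x, f₁ x * (antiVec (Φ i₁) (1 : G) x : F) ≠ 0) :
    typeRank G (sigmaType Φ) ≠ Fintype.card (Σ i, E i) / 2 + 1 :=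
  (typeRank_sigmaType_lt_of_shared' h h01 χ f₀ f₁ hf₀ hf₁ hc₀ hc₁).ne

/-- **No partial conjugation can exist** under a shared `F`-valued character with non-zero pairings (contrapositive of
rank additivity). [cite: Gordon1999HodgeAVSurvey, §3 Theorem (proof)] -/
theorem not_forall_exists_partialConj_of_shared' [Nonempty I] [∀ i, Nonempty (E i)] {ρ : G} {Φ : ∀ i, Set (E i)}
    (h : ∀ i, IsCMTypeWith ρ (Φ i)) {i₀ i₁ : I} (h01 : i₀ ≠ i₁) (χ : G → F) (f₀ : E i₀ → F) (f₁ : E i₁ → F)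
    (hf₀ : ∀ (g : G) (x : E i₀), f₀ (g • x) = χ g * f₀ x) (hf₁ : ∀ (g : G) (x : E i₁), f₁ (g • x) = χ g * f₁ x)
    (hc₀ : ∑ x, f₀ x * (antiVec (Φ i₀) (1 : G) x : F) ≠ 0)
    (hc₁ : ∑ x, f₁ x * (antiVec (Φ i₁) (1 : G) x : F) ≠ 0) :
    ¬ ∀ i, ∃ σ : G, (∀ s : E i, σ • s = ρ • s) ∧ ∀ j, j ≠ i → ∀ s : E j, σ • s = s := fun hconj => by
  have h1 := typeRank_sigmaType_add_card_eq_of_partialConj h hconj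
  have h2 := typeRank_sigmaType_add_card_lt_of_shared' h h01 χ f₀ f₁ hf₀ hf₁ hc₀ hc₁
  omega

/-! ### Nondegenerate slots sharing an odd character -/

/-- **Two NONDEGENERATE slots sharing an odd character are never additive**: if `rank(Φ_{i_k}) = |E_{i_k}|/2 + 1`
(`k = 0, 1`, `i₀ ≠ i₁`) and non-zero weights `f_k : E_{i_k} → F` transform under one odd `χ : G → F` (`χ(ρ) = −1`),
then `rank(Σ) + |I| < Σ_i rank(Φ_i) + 1`. [cite: Gordon1999HodgeAVSurvey, §3 Theorem (proof) and 7.5]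
[cite: Kubota1965, §4 Lemma 2] -/
theorem typeRank_sigmaType_add_card_lt_of_shared_odd [Nonempty I] [∀ i, Nonempty (E i)] {ρ : G}
    {Φ : ∀ i, Set (E i)} (h : ∀ i, IsCMTypeWith ρ (Φ i)) {i₀ i₁ : I} (h01 : i₀ ≠ i₁)
    (hnd₀ : typeRank G (Φ i₀) = Fintype.card (E i₀) / 2 + 1) (hnd₁ : typeRank G (Φ i₁) = Fintype.card (E i₁) / 2 + 1)
    (χ : G → F) (hρ : χ ρ = -1) (f₀ : E i₀ → F) (f₁ : E i₁ → F) (hf₀0 : f₀ ≠ 0) (hf₁0 : f₁ ≠ 0)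
    (hf₀ : ∀ (g : G) (x : E i₀), f₀ (g • x) = χ g * f₀ x) (hf₁ : ∀ (g : G) (x : E i₁), f₁ (g • x) = χ g * f₁ x) :
    typeRank G (sigmaType Φ) + Fintype.card I < (∑ i, typeRank G (Φ i)) + 1 :=
  typeRank_sigmaType_add_card_lt_of_shared' h h01 χ f₀ f₁ hf₀ hf₁
    ((h i₀).sum_mul_antiVec_ne_zero_of_typeRank_eq hnd₀ χ hρ f₀ hf₀ hf₀0)
    ((h i₁).sum_mul_antiVec_ne_zero_of_typeRank_eq hnd₁ χ hρ f₁ hf₁ hf₁0)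

/-- **… hence the family is DEGENERATE** (`rank(Σ) < |⊔_i E_i|/2 + 1`): on abelian varieties, for NONDEGENERATE
`A_{i₀}`, `A_{i₁}` whose embedding sets carry non-zero weights semi-invariant under one odd character of the Galois
action, some `∏_i A_i^{k_i}` supports an exceptional Hodge class (Murty–Hazama). [cite: Gordon1999HodgeAVSurvey, 7.5–7.7]
[cite: Kubota1965, §4 Lemma 2] -/
theorem typeRank_sigmaType_lt_of_shared_odd [Nonempty I] [∀ i, Nonempty (E i)] {ρ : G}
    {Φ : ∀ i, Set (E i)} (h : ∀ i, IsCMTypeWith ρ (Φ i)) {i₀ i₁ : I} (h01 : i₀ ≠ i₁)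
    (hnd₀ : typeRank G (Φ i₀) = Fintype.card (E i₀) / 2 + 1) (hnd₁ : typeRank G (Φ i₁) = Fintype.card (E i₁) / 2 + 1)
    (χ : G → F) (hρ : χ ρ = -1) (f₀ : E i₀ → F) (f₁ : E i₁ → F) (hf₀0 : f₀ ≠ 0) (hf₁0 : f₁ ≠ 0)
    (hf₀ : ∀ (g : G) (x : E i₀), f₀ (g • x) = χ g * f₀ x) (hf₁ : ∀ (g : G) (x : E i₁), f₁ (g • x) = χ g * f₁ x) :
    typeRank G (sigmaType Φ) < Fintype.card (Σ i, E i) / 2 + 1 :=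
  typeRank_sigmaType_lt_of_shared' h h01 χ f₀ f₁ hf₀ hf₁
    ((h i₀).sum_mul_antiVec_ne_zero_of_typeRank_eq hnd₀ χ hρ f₀ hf₀ hf₀0)
    ((h i₁).sum_mul_antiVec_ne_zero_of_typeRank_eq hnd₁ χ hρ f₁ hf₁ hf₁0)

/-- **… so `Σ` is not nondegenerate.** [cite: Gordon1999HodgeAVSurvey, 7.5–7.7] -/
theorem typeRank_sigmaType_ne_of_shared_odd [Nonempty I] [∀ i, Nonempty (E i)] {ρ : G}
    {Φ : ∀ i, Set (E i)} (h : ∀ i, IsCMTypeWith ρ (Φ i)) {i₀ i₁ : I} (h01 : i₀ ≠ i₁)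
    (hnd₀ : typeRank G (Φ i₀) = Fintype.card (E i₀) / 2 + 1) (hnd₁ : typeRank G (Φ i₁) = Fintype.card (E i₁) / 2 + 1)
    (χ : G → F) (hρ : χ ρ = -1) (f₀ : E i₀ → F) (f₁ : E i₁ → F) (hf₀0 : f₀ ≠ 0) (hf₁0 : f₁ ≠ 0)
    (hf₀ : ∀ (g : G) (x : E i₀), f₀ (g • x) = χ g * f₀ x) (hf₁ : ∀ (g : G) (x : E i₁), f₁ (g • x) = χ g * f₁ x) :
    typeRank G (sigmaType Φ) ≠ Fintype.card (Σ i, E i) / 2 + 1 :=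
  (typeRank_sigmaType_lt_of_shared_odd h h01 hnd₀ hnd₁ χ hρ f₀ f₁ hf₀0 hf₁0 hf₀ hf₁).ne

/-- **… and some slot has no partial conjugation** (for CM fields: some `L_i ∩ ∏_{j≠i} L_j` is not totally real).
[cite: Gordon1999HodgeAVSurvey, §3 Theorem (proof)] -/
theorem not_forall_exists_partialConj_of_shared_odd [Nonempty I] [∀ i, Nonempty (E i)] {ρ : G}
    {Φ : ∀ i, Set (E i)} (h : ∀ i, IsCMTypeWith ρ (Φ i)) {i₀ i₁ : I} (h01 : i₀ ≠ i₁)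
    (hnd₀ : typeRank G (Φ i₀) = Fintype.card (E i₀) / 2 + 1) (hnd₁ : typeRank G (Φ i₁) = Fintype.card (E i₁) / 2 + 1)
    (χ : G → F) (hρ : χ ρ = -1) (f₀ : E i₀ → F) (f₁ : E i₁ → F) (hf₀0 : f₀ ≠ 0) (hf₁0 : f₁ ≠ 0)
    (hf₀ : ∀ (g : G) (x : E i₀), f₀ (g • x) = χ g * f₀ x) (hf₁ : ∀ (g : G) (x : E i₁), f₁ (g • x) = χ g * f₁ x) :
    ¬ ∀ i, ∃ σ : G, (∀ s : E i, σ • s = ρ • s) ∧ ∀ j, j ≠ i → ∀ s : E j, σ • s = s :=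
  not_forall_exists_partialConj_of_shared' h h01 χ f₀ f₁ hf₀ hf₁
    ((h i₀).sum_mul_antiVec_ne_zero_of_typeRank_eq hnd₀ χ hρ f₀ hf₀ hf₀0)
    ((h i₁).sum_mul_antiVec_ne_zero_of_typeRank_eq hnd₁ χ hρ f₁ hf₁ hf₁0)

end Shared

end Literature.NumberTheory.ComplexMultiplication

end
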